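import Summits.BirchSwinnertonDyer.BirchSwinnertonDyer.Theorems.ResidualThetaTransportAtTwoThetaLayerLambdaCongruenceAtTwoHeckeAdjointFlagSide
import HarnessLib

/-!
# Crux `ThetaLayerLambdaCongruenceAtTwo` (stmt-BirchSwinnertonDyer-20688, route ResidualThetaTransportAtTwo), line
# `birth` v14 — SD floor, kernel road, Hecke clause of IP, brick HA4 «CONVEX RE-EXPANSION»: every generalised edge `C·{∞,0}`
# (`C ∈ M₂(ℤ)`, `det C > 0`) is re-expanded into a ONE-SIDED Farey path (negative continued fraction) from the cusp `C∞` to the cusp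
# `C0`, given as a list of `SL₂(ℤ)` matrices with the Manin-chain telescoping property (width seat bsd-wall-rtt-p3-w3 g11;
# `--supports stmt-BirchSwinnertonDyer-20688 --as helper`; closes nothing)

HONEST FRAMING. Elementary THEOREMS about integers, `2×2` integer matrices and lists; no definition; nothing about any curve or form is
asserted; BSD is not proved by any of this.

WHY (memo `Cruxes/ThetaLayerLambdaCongruenceAtTwo/Lines/birth-sd2-hecke-adjoint.md`, step (D), brick HA4). On the Manin side of the
adjointness identity the Hecke translate `M·L(γ')` of a Manin chain consists of generalised edges `C·{∞,0}`; to pair it with a dual chain through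
w2's crossing formula one needs honest Farey edges, i.e. a Manin chain. THEOREMS: (1) `exists_negCF` — the NEGATIVE CONTINUED FRACTION of
`v/w` (`w > 0`): integer vectors `P₀ = (1,0), P₁ = (⌈v/w⌉, 1), …, P_m ∝ (v, w)` with `y_j > 0`, consecutive determinants
`x_j y_{j+1} − x_{j+1} y_j = 1` and all vertices `x_j/y_j ≥ v/w` (CONVEX = one-sided: the vertices decrease monotonically from `∞` to `v/w`,
which is what makes the discrete Jordan lemma of brick HA5 finite); (2) `exists_reexpansion` — for `C = g₀·(u v; 0 w)` (Hermite form, as in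
`exists_flagAnchor`) the list `f_j = g₀·[P_{j−1} | P_j] ∈ SL₂(ℤ)` telescopes over cusp functions from the cusp `C∞` to the cusp `C0`
(`Σ_j F(f_j S) − F(f_j) = F(h₁) − F(h₀)`, first columns of `h₀, h₁` parallel to the columns of `C`), so that `f_j S` are Manin steps in the
sense of `…ManinChain` / `…CrossingPairing`.

References: [Manin1972] §1.5–1.7 (Manin's continued-fraction trick); [CremonaAlgorithms1997] §2.2; [Merel1995Homologie] §2.1 condition (C);
F. Hirzebruch, Hilbert modular surfaces, Enseign. Math. 19 (1973) §2.3 (negative continued fractions) — used only as folklore arithmetic.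
-/

set_option autoImplicit false

noncomputable section

-- justification: the `Summit.BirchSwinnertonDyer.BirchSwinnertonDyer.…` path repeats a component (route-file convention)
set_option linter.dupNamespace false

open scoped Classical MatrixGroups

open CongruenceSubgroup Matrix.SpecialLinearGroup ModularGroup
open Literature.NumberTheory.EllipticCurves.ModularForms

namespace Summit.BirchSwinnertonDyer.BirchSwinnertonDyer.Theorems.ThetaLayerLambdaCongruenceAtTwo

/-! ## §1. Negative continued fractions -/

section NegCF

/-- **Negative continued fraction of `v/w` as a convex Farey chain.** For `w > 0` there are `m ≥ 1` and integer vectors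
`P_j = (x_j, y_j)`, `0 ≤ j ≤ m`, with `P₀ = (1, 0)` (the cusp `∞`), `y_j > 0` for `j ≥ 1`, consecutive Farey neighbours
`x_j y_{j+1} − x_{j+1} y_j = 1`, every vertex on one side `v·y_j ≤ w·x_j` (`x_j/y_j ≥ v/w`), and `(v, w) = d·P_m` with `d > 0`.
(Induction on `w`: `a = ⌈v/w⌉`, `w' = aw − v ∈ [0, w)`; if `w' > 0` recurse on `w/w'` and apply `z ↦ a − 1/z`, i.e. `P ↦ (a −1; 1 0)·P`.)
[cite: Manin1972, §1.5] -/
theorem exists_negCF (v w : ℤ) (hw : 0 < w) :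
    ∃ (m : ℕ) (x y : ℕ → ℤ), 1 ≤ m ∧ x 0 = 1 ∧ y 0 = 0 ∧ (∀ j, 1 ≤ j → j ≤ m → 0 < y j) ∧
      (∀ j, j < m → x j * y (j + 1) - x (j + 1) * y j = 1) ∧ (∀ j, 1 ≤ j → j ≤ m → v * y j ≤ w * x j) ∧
      ∃ d : ℤ, 0 < d ∧ v = d * x m ∧ w = d * y m := by
  -- strong induction on `w.toNat`
  suffices H : ∀ (n : ℕ) (v w : ℤ), 0 < w → w.toNat = n →
      ∃ (m : ℕ) (x y : ℕ → ℤ), 1 ≤ m ∧ x 0 = 1 ∧ y 0 = 0 ∧ (∀ j, 1 ≤ j → j ≤ m → 0 < y j) ∧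
        (∀ j, j < m → x j * y (j + 1) - x (j + 1) * y j = 1) ∧ (∀ j, 1 ≤ j → j ≤ m → v * y j ≤ w * x j) ∧
        ∃ d : ℤ, 0 < d ∧ v = d * x m ∧ w = d * y m from H _ v w hw rfl
  intro n
  induction n using Nat.strong_induction_on with
  | _ n ih =>
    intro v w hw hn
    -- `a = ⌈v/w⌉ = -((-v)/w)`, `w' = a w - v ∈ [0, w)`
    set a : ℤ := -((-v) / w) with ha
    set w' : ℤ := a * w - v with hw'
    have hdm : w * ((-v) / w) + (-v) % w = -v := Int.mul_ediv_add_emod (-v) w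
    have hr0 : 0 ≤ (-v) % w := Int.emod_nonneg _ hw.ne'
    have hrw : (-v) % w < w := Int.emod_lt_of_pos _ hw
    have hw'0 : 0 ≤ w' := by rw [hw', ha]; linarith
    have hw'w : w' < w := by rw [hw', ha]; linarith
    rcases hw'0.lt_or_eq with hpos | hzero
    · -- recurse on `(w, w')`
      have hlt : w'.toNat < n := by
        rw [← hn]
        exact (Int.toNat_lt_toNat hw).mpr hw'w
      obtain ⟨m', x', y', hm', hx'0, hy'0, hy'pos, hdet', hconv', d', hd', hv', hw''⟩ := ih _ hlt w w' hpos rfl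
      -- positivity of the sub-path numerators: `w·y'_j ≤ w'·x'_j` with `w > 0`, `y'_j ≥ 1`, `w' > 0`
      have hx'pos : ∀ j, 1 ≤ j → j ≤ m' → 0 < x' j := by
        intro j hj1 hjm
        have h1 := hconv' j hj1 hjm
        have h2 := hy'pos j hj1 hjm
        nlinarith
      refine ⟨m' + 1, fun j ↦ if j = 0 then 1 else a * x' (j - 1) - y' (j - 1),
        fun j ↦ if j = 0 then 0 else x' (j - 1), by omega, by simp, by simp, ?_, ?_, ?_, ?_⟩
      · -- `y_j = x'_{j-1} > 0` (`j ≥ 2`), `y_1 = x'_0 = 1`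
        intro j hj1 hjm
        dsimp only
        rw [if_neg (by omega)]
        rcases Nat.lt_or_ge 1 j with hj | hj
        · exact hx'pos (j - 1) (by omega) (by omega)
        · have : j = 1 := le_antisymm hj hj1
          subst this
          simp [hx'0]
      · -- determinants
        intro j hjm
        dsimp only
        rcases Nat.eq_zero_or_pos j with rfl | hj
        · simp [hx'0, hy'0]
        · rw [if_neg (by omega), if_neg (by omega), if_neg (by omega), if_neg (by omega),
            show j + 1 - 1 = j - 1 + 1 by omega]
          have h := hdet' (j - 1) (by omega)
          linear_combination h
      · -- convexity `v y_j ≤ w x_j`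
        intro j hj1 hjm
        dsimp only
        rw [if_neg (by omega), if_neg (by omega)]
        rcases Nat.lt_or_ge 1 j with hj | hj
        · have h1 := hconv' (j - 1) (by omega) (by omega)
          -- `w (a x' - y') - v x' = x' w' - w y' ≥ 0`
          nlinarith
        · have : j = 1 := le_antisymm hj hj1
          subst this
          simp only [le_refl, tsub_eq_zero_of_le, hx'0, hy'0, mul_one, sub_zero]
          nlinarith
      · -- endpoint `(v, w) = d' · P_m`
        refine ⟨d', hd', ?_, ?_⟩
        · dsimp only
          rw [if_neg (by omega), show m' + 1 - 1 = m' by omega]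
          have : v = a * w - w' := by rw [hw']; ring
          rw [this, hv', hw'']; ring
        · dsimp only
          rw [if_neg (by omega), show m' + 1 - 1 = m' by omega, ← hv']
    · -- `w' = 0`: `v = a w`, one edge `∞ → a`
      refine ⟨1, fun j ↦ if j = 0 then 1 else a, fun j ↦ if j = 0 then 0 else 1, le_rfl, by simp, by simp, ?_, ?_, ?_, ?_⟩
      · intro j hj1 hjm
        dsimp only
        rw [if_neg (by omega)]; exact one_pos
      · intro j hjm
        have : j = 0 := by omega
        subst this; simp
      · intro j hj1 hjm
        dsimp only
        rw [if_neg (by omega), if_neg (by omega)]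
        have : v = a * w := by linarith
        rw [this]; nlinarith
      · refine ⟨w, hw, ?_, ?_⟩
        · dsimp only
          rw [if_neg (by omega)]; linarith
        · dsimp only
          rw [if_neg (by omega), mul_one]

end NegCF

/-! ## §2. The re-expansion list and its telescoping -/

section ReexpList

/-- Matrices with the same first column differ by a power of `T` on the right. [folklore] -/
theorem exists_eq_mul_T_zpow_of_col_eq (g g' : SL(2, ℤ)) (h0 : g' 0 0 = g 0 0) (h1 : g' 1 0 = g 1 0) :
    ∃ k : ℤ, g' = g * T ^ k := by
  refine ⟨(g⁻¹ * g') 0 1, ?_⟩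
  have hdet : g 0 0 * g 1 1 - g 0 1 * g 1 0 = 1 := by
    have := Matrix.det_fin_two g.1; rw [g.2] at this; linear_combination -this
  have hdet' : g' 0 0 * g' 1 1 - g' 0 1 * g' 1 0 = 1 := by
    have := Matrix.det_fin_two g'.1; rw [g'.2] at this; linear_combination -this
  have e00 : (g⁻¹ * g') 0 0 = 1 := by
    rw [Matrix.SpecialLinearGroup.coe_mul, Matrix.SpecialLinearGroup.coe_inv, Matrix.adjugate_fin_two]
    simp [Matrix.mul_apply, Fin.sum_univ_two]; rw [h0, h1]; linear_combination hdet
  have e10 : (g⁻¹ * g') 1 0 = 0 := by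
    rw [Matrix.SpecialLinearGroup.coe_mul, Matrix.SpecialLinearGroup.coe_inv, Matrix.adjugate_fin_two]
    simp [Matrix.mul_apply, Fin.sum_univ_two]; rw [h0, h1]; ring
  have e11 : (g⁻¹ * g') 1 1 = 1 := by
    have := Matrix.det_fin_two (g⁻¹ * g').1
    rw [(g⁻¹ * g').2] at this
    have h : (g⁻¹ * g') 0 0 * (g⁻¹ * g') 1 1 - (g⁻¹ * g') 0 1 * (g⁻¹ * g') 1 0 = 1 := by linear_combination -this
    rw [e00, e10, mul_zero, sub_zero, one_mul] at h
    exact h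
  have key : g⁻¹ * g' = T ^ ((g⁻¹ * g') 0 1) := by
    ext i j
    rw [ModularGroup.coe_T_zpow]
    fin_cases i <;> fin_cases j <;> simp [e00, e10, e11]
  rw [← key, mul_inv_cancel_left]

/-- **The re-expansion list of a negative continued fraction.** For `w > 0` and any `v`: the convex Farey chain `P₀ = (1,0), …, P_m ∝ (v,w)`
of `exists_negCF` together with the list `P = [f₁, …, f_m]`, `f_j = [P_{j−1} | P_j] ∈ SL₂(ℤ)`, which TELESCOPES over cusp functions:
`Σ_j (F(f_j S) − F(f_j)) = F(h₁) − F(1)` with `h₁ = f_m S`, whose first column is `P_m` (the steps `f_j S` go from the cusp of `P_{j−1}` to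
the cusp of `P_j`, starting at `∞`). [cite: Manin1972, §1.5–1.7] -/
theorem exists_negCF_list (v w : ℤ) (hw : 0 < w) :
    ∃ (m : ℕ) (x y : ℕ → ℤ) (P : List SL(2, ℤ)) (h₁ : SL(2, ℤ)), 1 ≤ m ∧ x 0 = 1 ∧ y 0 = 0 ∧ (∀ j, 1 ≤ j → j ≤ m → 0 < y j) ∧
      (∀ j, j < m → x j * y (j + 1) - x (j + 1) * y j = 1) ∧ (∀ j, 1 ≤ j → j ≤ m → v * y j ≤ w * x j) ∧
      (∃ d : ℤ, 0 < d ∧ v = d * x m ∧ w = d * y m) ∧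
      P.length = m ∧
      (∀ (j : ℕ) (hj : j < P.length), ((P[j] : SL(2, ℤ)) : Matrix (Fin 2) (Fin 2) ℤ) = !![x j, x (j + 1); y j, y (j + 1)]) ∧
      h₁ 0 0 = x m ∧ h₁ 1 0 = y m ∧
      ∀ {A : Type} [AddCommGroup A] (F : SL(2, ℤ) → A), (∀ g, F (g * T) = F g) → (∀ g, F (-g) = F g) →
        (P.map fun f ↦ F (f * S) - F f).sum = F h₁ - F 1 := by
  obtain ⟨m, x, y, hm, hx0, hy0, hypos, hdet, hconv, hd⟩ := exists_negCF v w hw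
  -- the edge matrices
  let E : Fin m → SL(2, ℤ) := fun j ↦ ⟨!![x j, x (j + 1); y j, y (j + 1)], by
    rw [Matrix.det_fin_two_of]; linear_combination hdet j j.2⟩
  have hEcoe : ∀ j : Fin m, ((E j : SL(2, ℤ)) : Matrix (Fin 2) (Fin 2) ℤ) = !![x j, x (j + 1); y j, y (j + 1)] := fun j ↦ rfl
  -- a matrix with first column `P_j` for every `j ≤ m`: `E j` for `j < m`, `E (m-1) · S` for `j = m`
  have hm0 : 0 < m := hm
  let last : SL(2, ℤ) := E ⟨m - 1, by omega⟩ * S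
  have hlast0 : last 0 0 = x m ∧ last 1 0 = y m := by
    obtain ⟨s00, -, s10, -⟩ := mul_S_apply (E ⟨m - 1, by omega⟩)
    refine ⟨s00.trans ?_, s10.trans ?_⟩
    · show (!![x (m - 1), x (m - 1 + 1); y (m - 1), y (m - 1 + 1)] : Matrix (Fin 2) (Fin 2) ℤ) 0 1 = x m
      simp [show m - 1 + 1 = m by omega]
    · show (!![x (m - 1), x (m - 1 + 1); y (m - 1), y (m - 1 + 1)] : Matrix (Fin 2) (Fin 2) ℤ) 1 1 = y m
      simp [show m - 1 + 1 = m by omega]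
  refine ⟨m, x, y, List.ofFn E, last, hm, hx0, hy0, hypos, hdet, hconv, hd, List.length_ofFn, ?_, hlast0.1, hlast0.2, ?_⟩
  · intro j hj
    rw [List.getElem_ofFn]
  · intro A _ F hT hneg
    -- `F` only depends on the first column
    have hcol : ∀ g g' : SL(2, ℤ), g' 0 0 = g 0 0 → g' 1 0 = g 1 0 → F g' = F g := by
      intro g g' h0 h1
      obtain ⟨k, rfl⟩ := exists_eq_mul_T_zpow_of_col_eq g g' h0 h1
      -- `F (g T^k) = F g`
      have hTk : ∀ (k : ℕ) (g : SL(2, ℤ)), F (g * T ^ k) = F g := by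
        intro k; induction k with
        | zero => intro g; simp
        | succ k ih => intro g; rw [pow_succ, ← mul_assoc, hT, ih]
      rcases Int.eq_nat_or_neg k with ⟨n, rfl | rfl⟩
      · exact_mod_cast hTk n g
      · have h := hTk n (g * T ^ (-(n : ℤ)))
        rw [mul_assoc, ← zpow_natCast, ← zpow_add, neg_add_cancel, zpow_zero, mul_one] at h
        exact h.symm
    -- the value at the `j`-th vertex
    let a : ℕ → A := fun j ↦ if h : j < m then F (E ⟨j, h⟩) else F last
    have hstep : ∀ j : Fin m, F (E j * S) - F (E j) = a (j + 1) - a j := by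
      intro j
      have hj := j.2
      simp only [a, dif_pos hj]
      congr 1
      by_cases hj1 : (j : ℕ) + 1 < m
      · rw [dif_pos hj1]
        apply hcol
        · rw [(mul_S_apply (E j)).1]; rfl
        · rw [(mul_S_apply (E j)).2.2.1]; rfl
      · rw [dif_neg hj1]
        have : j = ⟨m - 1, by omega⟩ := Fin.ext (by simp; omega)
        rw [this]
    rw [List.map_ofFn, List.sum_ofFn]
    simp only [Function.comp_apply, hstep]
    rw [Fin.sum_univ_eq_sum_range (fun j ↦ a (j + 1) - a j) m, Finset.sum_range_sub]
    simp only [a, dif_neg (lt_irrefl m), dif_pos hm0]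
    congr 1
    apply hcol
    · show (!![x 0, x (0 + 1); y 0, y (0 + 1)] : Matrix (Fin 2) (Fin 2) ℤ) 0 0 = (1 : SL(2, ℤ)) 0 0
      simp [hx0]
    · show (!![x 0, x (0 + 1); y 0, y (0 + 1)] : Matrix (Fin 2) (Fin 2) ℤ) 1 0 = (1 : SL(2, ℤ)) 1 0
      simp [hy0]

end ReexpList

/-! ## §3. Re-expansion of a generalised edge -/

section Reexpansion

/-- **Hermite normal form** (first column): every integer matrix `C` with `det C > 0` is `g₀·(u v; 0 w)` with `g₀ ∈ SL₂(ℤ)`,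
`u = gcd(C₀₀, C₁₀) > 0`, `w > 0` (Bezout). [folklore] -/
theorem exists_hermite (C : Matrix (Fin 2) (Fin 2) ℤ) (hC : 0 < C.det) :
    ∃ (g₀ : SL(2, ℤ)) (u v w : ℤ), 0 < u ∧ 0 < w ∧ C = (g₀ : Matrix (Fin 2) (Fin 2) ℤ) * !![u, v; 0, w] := by
  have hdetC : C.det = C 0 0 * C 1 1 - C 0 1 * C 1 0 := by rw [Matrix.det_fin_two]
  have hk0 : (Int.gcd (C 0 0) (C 1 0) : ℤ) ≠ 0 := by
    intro h
    have h' : Int.gcd (C 0 0) (C 1 0) = 0 := by exact_mod_cast h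
    rw [Int.gcd_eq_zero_iff] at h'
    rw [hdetC, h'.1, h'.2] at hC
    simp at hC
  have hkpos : 0 < (Int.gcd (C 0 0) (C 1 0) : ℤ) := lt_of_le_of_ne (by positivity) (Ne.symm hk0)
  obtain ⟨a', ha'⟩ := Int.gcd_dvd_left (C 0 0) (C 1 0)
  obtain ⟨c', hc'⟩ := Int.gcd_dvd_right (C 0 0) (C 1 0)
  set k : ℤ := (Int.gcd (C 0 0) (C 1 0) : ℤ) with hk
  set A : ℤ := Int.gcdA (C 0 0) (C 1 0) with hA
  set B : ℤ := Int.gcdB (C 0 0) (C 1 0) with hB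
  have hbez : k = C 0 0 * A + C 1 0 * B := Int.gcd_eq_gcd_ab (C 0 0) (C 1 0)
  have h1 : a' * A + c' * B = 1 := by
    have h : k * (a' * A + c' * B) = k * 1 := by
      rw [mul_one]
      calc k * (a' * A + c' * B) = (k * a') * A + (k * c') * B := by ring
        _ = C 0 0 * A + C 1 0 * B := by rw [← ha', ← hc']
        _ = k := hbez.symm
    exact mul_left_cancel₀ hk0 h
  let g₀ : SL(2, ℤ) := ⟨!![a', -B; c', A], by rw [Matrix.det_fin_two_of]; linear_combination h1⟩
  have hg₀coe : (g₀ : Matrix (Fin 2) (Fin 2) ℤ) = !![a', -B; c', A] := rfl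
  have hg₀inv : ((g₀⁻¹ : SL(2, ℤ)) : Matrix (Fin 2) (Fin 2) ℤ) = !![A, B; -c', a'] := by
    rw [Matrix.SpecialLinearGroup.coe_inv, hg₀coe, Matrix.adjugate_fin_two_of, neg_neg]
  set H : Matrix (Fin 2) (Fin 2) ℤ := ((g₀⁻¹ : SL(2, ℤ)) : Matrix (Fin 2) (Fin 2) ℤ) * C with hH
  have H00 : H 0 0 = k := by
    have e : H 0 0 = A * C 0 0 + B * C 1 0 := by
      rw [hH, hg₀inv]; simp [Matrix.mul_apply, Fin.sum_univ_two]
    rw [e, hbez]; ring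
  have H10 : H 1 0 = 0 := by
    have e : H 1 0 = -c' * C 0 0 + a' * C 1 0 := by
      rw [hH, hg₀inv]; simp [Matrix.mul_apply, Fin.sum_univ_two]
    rw [e, ha', hc']; ring
  have hdetH : H.det = C.det := by
    rw [hH, Matrix.det_mul, Matrix.SpecialLinearGroup.det_coe, one_mul]
  have H11 : 0 < H 1 1 := by
    have h : H 0 0 * H 1 1 - H 0 1 * H 1 0 = C.det := by rw [← Matrix.det_fin_two, hdetH]
    rw [H00, H10, mul_zero, sub_zero] at h
    rcases lt_trichotomy 0 (H 1 1) with hlt | heq | hgt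
    · exact hlt
    · rw [← heq, mul_zero] at h; linarith
    · nlinarith
  refine ⟨g₀, k, H 0 1, H 1 1, hkpos, H11, ?_⟩
  have hHeta : H = !![k, H 0 1; 0, H 1 1] := by
    conv_lhs => rw [Matrix.eta_fin_two H]
    rw [H00, H10]
  rw [← hHeta, hH, ← Matrix.mul_assoc, ← Matrix.SpecialLinearGroup.coe_mul, mul_inv_cancel,
    Matrix.SpecialLinearGroup.coe_one, Matrix.one_mul]

/-- **Re-expansion of a generalised edge (brick HA4).** For an integer matrix `C` with `det C > 0` — the generalised edge from the cusp
`C∞` to the cusp `C0` — there are: its Hermite form `C = g₀·(u v; 0 w)`, the convex Farey chain `P₀, …, P_m` of `v/w` (`exists_negCF`) and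
the list `P = [f₁, …, f_m]`, `f_j = [P_{j−1} | P_j]`, such that the translated list `g₀·P` TELESCOPES over cusp functions from the cusp
`C∞` (= cusp of `g₀`) to the cusp `C0` (= cusp of `g₀ h₁`, first column `P_m`): `Σ_j F(g₀f_jS) − F(g₀f_j) = F(g₀h₁) − F(g₀)`; with the
column identities `C_{i0} = u·(g₀)_{i0}`, `C_{i1} = d·(g₀h₁)_{i0}`. Hence `(g₀f_j)·S` are Manin steps (`…CrossingPairing`) re-expanding
`C`, and the vertex data `(x, y)` feed the discrete Jordan lemma (brick HA5). [cite: Manin1972, §1.5–1.7] [cite: Merel1995Homologie, §2.1] -/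
theorem exists_reexpansion (C : Matrix (Fin 2) (Fin 2) ℤ) (hC : 0 < C.det) :
    ∃ (g₀ : SL(2, ℤ)) (u v w : ℤ) (m : ℕ) (x y : ℕ → ℤ) (P : List SL(2, ℤ)) (h₁ : SL(2, ℤ)) (d : ℤ),
      0 < u ∧ 0 < w ∧ C = (g₀ : Matrix (Fin 2) (Fin 2) ℤ) * !![u, v; 0, w] ∧
      1 ≤ m ∧ x 0 = 1 ∧ y 0 = 0 ∧ (∀ j, 1 ≤ j → j ≤ m → 0 < y j) ∧
      (∀ j, j < m → x j * y (j + 1) - x (j + 1) * y j = 1) ∧ (∀ j, 1 ≤ j → j ≤ m → v * y j ≤ w * x j) ∧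
      0 < d ∧ v = d * x m ∧ w = d * y m ∧
      P.length = m ∧
      (∀ (j : ℕ) (hj : j < P.length), ((P[j] : SL(2, ℤ)) : Matrix (Fin 2) (Fin 2) ℤ) = !![x j, x (j + 1); y j, y (j + 1)]) ∧
      h₁ 0 0 = x m ∧ h₁ 1 0 = y m ∧
      (∀ {A : Type} [AddCommGroup A] (F : SL(2, ℤ) → A), (∀ g, F (g * T) = F g) → (∀ g, F (-g) = F g) →
        ((P.map fun f ↦ g₀ * f).map fun f ↦ F (f * S) - F f).sum = F (g₀ * h₁) - F g₀) ∧
      (∀ i, C i 0 = u * g₀ i 0) ∧ (∀ i, C i 1 = d * (g₀ * h₁) i 0) := by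
  obtain ⟨g₀, u, v, w, hu, hw, hCeq⟩ := exists_hermite C hC
  obtain ⟨m, x, y, P, h₁, hm, hx0, hy0, hypos, hdet, hconv, ⟨d, hd, hvd, hwd⟩, hlen, hget, h100, h110, htel⟩ :=
    exists_negCF_list v w hw
  refine ⟨g₀, u, v, w, m, x, y, P, h₁, d, hu, hw, hCeq, hm, hx0, hy0, hypos, hdet, hconv, hd, hvd, hwd, hlen, hget, h100, h110,
    ?_, ?_, ?_⟩
  · intro A _ F hT hneg
    rw [List.map_map]
    have h := htel (fun g ↦ F (g₀ * g)) (fun g ↦ by simp only [← mul_assoc, hT]) (fun g ↦ by simp only [mul_neg, hneg])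
    simp only [mul_one] at h
    rw [← h]
    congr 1
    exact List.map_congr_left fun f _ ↦ by simp [mul_assoc]
  · intro i
    rw [hCeq, Matrix.mul_apply, Fin.sum_univ_two]
    fin_cases i <;> simp <;> ring
  · intro i
    rw [hCeq, Matrix.mul_apply, Fin.sum_univ_two, Matrix.SpecialLinearGroup.coe_mul, Matrix.mul_apply, Fin.sum_univ_two,
      h100, h110, hvd, hwd]
    fin_cases i <;> simp <;> ring

end Reexpansion

end Summit.BirchSwinnertonDyer.BirchSwinnertonDyer.Theorems.ThetaLayerLambdaCongruenceAtTwo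

end
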